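import Mathlib
import HarnessLib
import Literature.Analysis.FluidPDE.SelfSimilar
import Literature.Analysis.FluidPDE.VectorCalculus
import Literature.Analysis.FluidPDE.Vorticity
import Literature.Analysis.FluidPDE.NSBoundedMildOseen
import Summits.NavierStokesRegularity.NavierStokesRegularity.Theses.ThreadingFlux
import Summits.NavierStokesRegularity.NavierStokesRegularity.Theses.UnthreadedRigidityDoor

/-!
# Crux idea «ladder-cone» — typed sketch v1.3 (planner ns-idea-15 g13, lens «negation», 0 kit)

(v1.1, 2026-08-29: `IsPoloidalDatum` carries a bounded-gradient clause — used only in «W2 ⇒ K2».  v1.2: «W2 ⇒ K2» is now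
KERNEL-CHECKED modulo one typed standard fact: `smallAmplitudeWindowRigidity_of_unthreadedRigidity : UnthreadedRigidity →
MildLocalTheory → SmallAmplitudeWindowRigidity`.  v1.3 ERRATUM (same day, found by the author): K0 of v1.0–1.2 («second-order
survivors = cone ∪ axisymmetric») is FALSE as stated — the SEPARABLE data `P = p(‖y‖)·Y_l(y)` (one angular degree, free radial
profile) are a second exactly-silent class; K0 is corrected to the three-class form, the separable stratum gets its own third-order
conjecture K1s with engine evidence (`engine/ladder_sep.py`), `IsPoloidalDatum` now asks all derivatives bounded (so the Leray
pressure of the self-interaction exists for every datum of the class) and `door_closed` takes K1s as a fourth hypothesis.)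

Crux: stmt-NavierStokesRegularity-1222 `…Theses.ThreadingFlux.PoloidalLiouville` (wall W1 = registered stub
`stub_scalarLiouville` of the antidynamo skeleton v2).  SAME-WALL: the lever bites W2 = stmt-27585
`UnthreadedRigidityDoor.UnthreadedRigidity` (stub_shearedRigidity) and is information-grade for W1.
NS regularity is NOT proved; `PoloidalLiouville` ⟨1222⟩ and `UnthreadedRigidity` ⟨27585⟩ are OPEN; nothing here proves them.
Props + kernel-checked glue only, no `sorry`.  LABEL: `IsoMomentalSilent`, `LadderSecondOrderSilent`, `QuadrupoleRungIsLadder`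
and `QuadrupoleRungThreads` are PAPER/ENGINE-proved (card §Results, exact rational jet arithmetic, files `engine/ladder_tower.py`,
`engine/ladder_o3.py`); `SeparableSecondOrderSilent` likewise (one-line coplanarity, v1.3); `SecondOrderSurvivorsRigidity` (K0, corrected v1.3),
`LadderThirdOrderRigidity` (K1), `SeparableThirdOrderRigidity` (K1s, v1.3) are CONJECTURES; `AmplitudeExpansion`
(P1) is standard L^∞-mild perturbation theory, unproved in the tree; `SmallAmplitudeWindowRigidity` (K2) is the door they close.

NEGATION LENS.  A counterexample to W2 (a bounded, Oseen-mild, unthreaded but NOT axisymmetric window solution) is sought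
perturbatively: `u^ε(t) = Σ εⁿ uₙ(t)` from a bounded smooth poloidal (= divergence-free + unthreaded) datum `ε u₀`.
Write `y = x − x₀`, `ω = curl u = ∇T × y` (toroidal potential `T`), `m = ⟪u, y⟫` (loop momentum).  The radial-vorticity
(«threading») source of the quadratic interaction of an unthreaded field `w` is the EULER THREADING RATE
`Θ₂[w] := ⟪y, curl(curl w × w)⟫ = −curl w · ∇m_w`.
* ORDER 1 is free (Stokes flow preserves unthreadedness).
* ORDER 2 vanishes for all `t` iff `Θ₂[e^{sΔ}u₀] ≡ 0` for all `s` («two-caloric coplanarity» `det[y, ∇T_s, ∇m_s] ≡ 0` of two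
  FREE HEAT solutions).  THE NEW OBJECT: the ISO-MOMENTAL LADDER CONE
      `V_λ(x₀) := { u₀ poloidal about x₀ : m₀ = λ T₀ + R(‖y‖) }`,  `λ > 0` one GLOBAL constant,
  = Mie scalars in `ker(L² + λΔ)` = superpositions of the Stokes eigen-rungs `j_l(k_l r) Y_l`, `k_l² = l(l+1)/λ` (one radial
  frequency per angular degree; bounded, smooth, `O(1/r)`, NON-axisymmetric for biaxial / tilted data, infinite-dimensional).
  `V_λ` is invariant under the heat flow and `Θ₂ ≡ 0` on it identically (`IsoMomentalSilent`, `LadderSecondOrderSilent`):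
  the cone is EXACTLY SILENT AT SECOND ORDER FOR ALL TIMES.  A SECOND silent class (v1.3 ERRATUM — omitted in v1.0–1.2): the
  SEPARABLE data `P = p(‖y‖)·Y_l(y)` — ONE angular degree, one solid harmonic `Y_l`, FREE radial profile `p`: then `T = a(r)Y_l`,
  `m = l(l+1)p(r)Y_l`, so `y, ∇T, ∇m ∈ span{y, ∇Y_l}` and `det[y, ∇T, ∇m] ≡ 0`; the heat flow preserves the class
  (`IsSeparableAbout`, `SeparableSecondOrderSilent`).  Cone ∩ separable = the single rungs; g3's «iso-λ(r) shells» are separable.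
  Conjecture K0 (corrected): CONE ∪ SEPARABLE ∪ AXISYMMETRIC is all of the second-order silent set (engine cross-checks, v1.3: two
  l=2 shapes with different profiles thread at second order from jet degree 3; a rung plus an off-ladder separable piece from
  degree 2; the level-one caloric identity `(∂ₛ − Δ)det[y,∇T,∇m] = −2Σₖdet[y,∇∂ₖT,∇∂ₖm]` is consistent with exactly these classes).
* ORDER 3 on a second-order survivor: `⟪y, curl u₃(t)⟫ = (t²/2)·Θ₃ + O(t³)`, with the THIRD-ORDER RATE
      `Θ₃ := ⟪y, curl(curl u₀ × Q + curl Q × u₀)⟫ = det[y, ∇T₀, ∇m_Q] + det[y, ∇T_Q, ∇m₀]`,  `Q := Leray(u₀·∇u₀)` (poloidal!),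
  which on the cone is the LADDER DEFECT `det[y, ∇T₀, ∇𝔇_λ P_Q]`, `𝔇_λ := L² + λΔ`, `P_Q` the Mie scalar of `Q`: third-order
  silence on the cone ⟺ the self-interaction is LADDER-COHERENT with the datum.
  ENGINE THEOREM (exact rational jets, harmonic pressure ambiguity eliminated by linear algebra): `Θ₃ ≢ 0` on every tested
  non-axisymmetric stratum — l=2 biaxial, where EXACTLY `Θ₃ = 4 q(r²) f₂(r²) (b−a)(c−a)(c−b)·y₀y₁y₂` with a universal power
  series `f₂` whose gauge-invariant coefficients are `[r⁴] = −268/72765`, `[r⁶] = 32/184275`, `[r⁸] = −136/25540515`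
  (normalisation `q(0) = 1/15`); general quadrupole; l=1⊕l=2 tilted (three tilts); l=3 octupole `y₀y₁y₂`; l=3 zonal ⊕ tilted
  l=1 — and `Θ₃ ≡ 0` through the computed order on all six axisymmetric controls.  Conjecture K1: `Θ₃ ≡ 0` on `V_λ` forces
  axisymmetry.  SEPARABLE STRATUM (v1.3, `engine/ladder_sep.py`, gauge-free certificates): biaxial l=2 shape with Gaussian,
  shell `r²e^{−r²}`, Lorentzian and truncated-rung profile jets; general quadrupole × Gaussian; a two-shape separable sum; octupole
  `y₀y₁y₂` × Gaussian — ALL THREAD at third order; uniaxial × Gaussian is silent.  Conjecture K1s: `Θ₃ ≡ 0` on a separable datum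
  forces axisymmetry — for a FREE profile this is a GLOBAL rigidity statement (Θ₃ = shape-pseudoscalar × `F_p(r)`, `F_p` an
  integro-differential cubic functional of `p` through the Leray pressure); centre jets certify it profile by profile but not
  uniformly (one new profile coefficient enters per new jet degree).
* DOOR: `door_closed : AmplitudeExpansion → SecondOrderSurvivorsRigidity → LadderThirdOrderRigidity → SeparableThirdOrderRigidity →
  SmallAmplitudeWindowRigidity` (kernel-checked below): no analytic amplitude family through `0` refutes W2.  Conversely W2 ⇒ K2
  (`smallAmplitudeWindowRigidity_of_unthreadedRigidity`, kernel-checked modulo the standard fact `MildLocalTheory`), so a biaxial member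
  of `V_λ` — or (v1.3) a biaxial separable shell with a `Θ₃`-null profile — with all higher obstructions zero would have been the
  cheapest conceivable W2-refutation; the engine says every tested member of both classes threads at third order instead.
-/

set_option linter.dupNamespace false

namespace Summit.NavierStokesRegularity.NavierStokesRegularity.Cruxes.PoloidalLiouville.LadderCone

open scoped Topology RealInnerProductSpace
open Filter Set Function
open Literature.Analysis.FluidPDE Literature.Analysis.UnboundedOperators

local notation "E" => EuclideanSpace ℝ (Fin 3)

/-! ### Objects -/

/-- `w` is UNTHREADED about `x₀`: its vorticity has no radial component, `⟪x − x₀, curl w x⟫ = 0`. -/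
def IsUnthreadedAbout (x₀ : E) (w : E → E) : Prop :=
  ∀ x, inner ℝ (x - x₀) (curl w x) = 0

/-- Infinitesimal axisymmetry about an axis through `x₀` — verbatim the conclusion shape of `UnthreadedRigidity` ⟨27585⟩. -/
def IsInfAxisymmetricAbout (x₀ : E) (w : E → E) : Prop :=
  ∃ A : E →L[ℝ] E, (∀ x, inner ℝ (A x) x = 0) ∧ A ≠ 0 ∧ ∀ x, fderiv ℝ w x (A (x - x₀)) - A (w x) = 0

/-- THE NEW OBJECT.  `w` lies on the ISO-MOMENTAL LADDER CONE `V_λ(x₀)`: it has a smooth toroidal potential `T`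
(`curl w = ∇T × (x − x₀)`) and its loop momentum is `λ T` up to a radial function: `⟪w x, x − x₀⟫ = λ T x + R ‖x − x₀‖`.
(For bounded smooth divergence-free `w` this says: the Mie scalar lies in `ker(L² + λΔ)`.) -/
def IsIsoMomental (x₀ : E) (lam : ℝ) (w : E → E) : Prop :=
  ∃ (T : E → ℝ) (R : ℝ → ℝ), ContDiff ℝ (⊤ : ℕ∞) T ∧ (∀ x, curl w x = cross (gradient T x) (x - x₀)) ∧
    ∀ x, inner ℝ (w x) (x - x₀) = lam * T x + R ‖x - x₀‖

/-- EULER THREADING RATE `Θ₂[w](x) := ⟪x − x₀, curl (curl w × w) x⟫` — the radial-vorticity source of the quadratic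
self-interaction (Lamb vector) of `w`; for unthreaded `w` it equals `−curl w · ∇⟪w, x − x₀⟫`. -/
noncomputable def eulerThreadingRate (x₀ : E) (w : E → E) (x : E) : ℝ :=
  inner ℝ (x - x₀) (curl (fun z => cross (curl w z) (w z)) x)

/-- Scalar Laplacian as `div ∇`. -/
noncomputable def scalarLaplacian (f : E → ℝ) (x : E) : ℝ :=
  VectorCalculus.divergence (gradient f) x

/-- THE SECOND SILENT CLASS (v1.3).  `w` is SEPARABLE about `x₀`: for ONE smooth solid harmonic `Y` (homogeneous of degree
`l`, `ΔY = 0`) and radial functions `a, b`, the toroidal potential is `a(‖y‖)·Y(y)` and the loop momentum is `b(‖y‖)·Y(y)`,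
`y = x − x₀` — i.e. the Mie scalar is `p(‖y‖)·Y(y)` with a FREE radial profile.  Then `y, ∇T, ∇m ∈ span{y, ∇Y}`, so the Euler
threading rate vanishes identically, and the free heat flow preserves the class (it acts on `p(r)Y` through a radial operator
depending only on `l`).  Cone ∩ separable = single rungs (`p ∝ j_l(k_l r)`). -/
def IsSeparableAbout (x₀ : E) (w : E → E) : Prop :=
  ∃ (l : ℕ) (Y : E → ℝ) (a b : ℝ → ℝ), ContDiff ℝ (⊤ : ℕ∞) Y ∧ (∀ (c : ℝ) (z : E), Y (c • z) = c ^ l * Y z) ∧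
    (∀ z, scalarLaplacian Y z = 0) ∧
    (∀ x, curl w x = cross (gradient (fun z => a ‖z - x₀‖ * Y (z - x₀)) x) (x - x₀)) ∧
    ∀ x, inner ℝ (w x) (x - x₀) = b ‖x - x₀‖ * Y (x - x₀)

/-- `π` is a LERAY PRESSURE of the self-interaction of `w`: smooth, BOUNDED, `Δπ = −div((w·∇)w)` (bounded harmonic functions
are constant, so `∇π` — hence `Q` and `Θ₃` — is unique; for data decaying like `1/r`, e.g. every finite sum of rungs of the cone,
`π = RᵢRⱼ(wᵢwⱼ)` is such a pressure).  Boundedness is what removes the harmonic-polynomial ambiguity that DOES change `Θ₃`. -/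
def IsLerayPressure (w : E → E) (π : E → ℝ) : Prop :=
  ContDiff ℝ (⊤ : ℕ∞) π ∧ (∀ x, scalarLaplacian π x = - VectorCalculus.divergence (fun z => fderiv ℝ w z (w z)) x) ∧
    ∃ C : ℝ, ∀ x, |π x| ≤ C

/-- The Leray-projected self-interaction `Q := (w·∇)w + ∇π`. -/
noncomputable def selfInteraction (w : E → E) (π : E → ℝ) (x : E) : E :=
  fderiv ℝ w x (w x) + gradient π x

/-- THIRD-ORDER THREADING RATE (ladder defect) `Θ₃(x) := ⟪x − x₀, curl (curl w × Q + curl Q × w) x⟫`, `Q = selfInteraction w π`;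
on the cone `Θ₃ = det[x − x₀, ∇T₀, ∇(L² + λΔ)P_Q]` and `⟪x − x₀, curl u₃(t) x⟫ = (t²/2) Θ₃(x) + O(t³)` (card §Tower). -/
noncomputable def thirdOrderRate (x₀ : E) (w : E → E) (π : E → ℝ) (x : E) : ℝ :=
  inner ℝ (x - x₀) (curl (fun z => cross (curl w z) (selfInteraction w π z) + cross (curl (selfInteraction w π) z) (w z)) x)

/-- The hypothesis class of the door: smooth poloidal (divergence-free, unthreaded about `x₀`) data decaying like `1/r`
(hence bounded) with ALL DERIVATIVES BOUNDED (v1.3; v1.1 asked only the gradient).  Two uses: the `C¹` control makes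
`∇u^ε(t) → ε∇u₀` pointwise as `t → 0⁺` for the mild solution («W2 ⇒ K2»), and `u₀ ⊗ u₀ ∈ C^∞_b ∩ L^p` (`p > 3/2`) makes the Leray
pressure `π = R_iR_j(u₀ⁱu₀ʲ)` of the self-interaction exist, bounded and smooth, for EVERY datum of the class (P1 (ii)).  Every
finite sum of rungs of the cone and every separable datum with a Schwartz profile qualifies. -/
def IsPoloidalDatum (x₀ : E) (u₀ : E → E) : Prop :=
  ContDiff ℝ (⊤ : ℕ∞) u₀ ∧ (∃ C : ℝ, ∀ x, ‖u₀ x‖ * (1 + ‖x - x₀‖) ≤ C) ∧ (∀ n : ℕ, ∃ C : ℝ, ∀ x, ‖iteratedFDeriv ℝ n u₀ x‖ ≤ C) ∧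
    VectorCalculus.IsDivFree u₀ ∧ IsUnthreadedAbout x₀ u₀

/-- «Every bounded Oseen-mild window solution from `ε u₀` is unthreaded on `[0, t₁]`, for all small `ε > 0`» — the
hypothesis of the door statement K2 (mild form verbatim that of ⟨27585⟩ with initial time `0`). -/
def SmallFamilyUnthreaded (x₀ : E) (u₀ : E → E) (t₁ : ℝ) : Prop :=
  ∀ᶠ ε : ℝ in 𝓝[>] 0, ∀ u : ℝ → E → E,
    ContinuousOn (uncurry u) (Icc 0 t₁ ×ˢ univ) →
    (∃ B : ℝ, ∀ t ∈ Icc 0 t₁, ∀ x, ‖u t x‖ ≤ B) →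
    (u 0 = ε • u₀) →
    (∀ s ∈ Icc 0 t₁, ∀ t ∈ Icc 0 t₁, s < t → ∀ x, u t x = heatExtension (u s) (t - s) x - oseenDuhamel 1 s u u t x) →
    ∀ t ∈ Icc 0 t₁, IsUnthreadedAbout x₀ (u t)

/-! ### Proved on paper / by the exact engine (typed here as Props; provers may land them) -/

/-- A0 (pointwise identity, paper-proved): on the cone the Euler threading rate vanishes identically:
`Θ₂ = −(∇T × y)·∇(λT + R(‖y‖)) = 0`. -/
def IsoMomentalSilent : Prop :=
  ∀ (x₀ : E) (lam : ℝ) (w : E → E), ContDiff ℝ 2 w → IsIsoMomental x₀ lam w → ∀ x, eulerThreadingRate x₀ w x = 0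

/-- A (THEOREM A, paper-proved): the cone is heat-invariant, hence SILENT AT SECOND ORDER FOR ALL TIMES —
for bounded smooth divergence-free `w ∈ V_λ(x₀)`, `Θ₂[e^{sΔ} w] ≡ 0` for every `s > 0`
(`m_s = e^{sΔ}m₀ − 2s·div = λ T_s + e^{sΔ}R`, caloric closure of the Mie relations). -/
def LadderSecondOrderSilent : Prop :=
  ∀ (x₀ : E) (lam : ℝ) (w : E → E), ContDiff ℝ (⊤ : ℕ∞) w → (∃ C : ℝ, ∀ x, ‖w x‖ ≤ C) →
    VectorCalculus.IsDivFree w → IsIsoMomental x₀ lam w → ∀ s : ℝ, 0 < s → ∀ x, eulerThreadingRate x₀ (heatExtension w s) x = 0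

/-- A' (v1.3, paper-proved, one line + heat invariance): a bounded smooth divergence-free SEPARABLE datum is silent at second
order for all times — `Θ₂[e^{sΔ}w] ≡ 0` for every `s ≥ 0` (coplanarity `y, ∇T_s, ∇m_s ∈ span{y, ∇Y}`). -/
def SeparableSecondOrderSilent : Prop :=
  ∀ (x₀ : E) (w : E → E), ContDiff ℝ (⊤ : ℕ∞) w → (∃ C : ℝ, ∀ x, ‖w x‖ ≤ C) →
    VectorCalculus.IsDivFree w → IsSeparableAbout x₀ w → ∀ s : ℝ, 0 < s → ∀ x, eulerThreadingRate x₀ (heatExtension w s) x = 0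

/-- The l = 2 rung profile `q(ρ) = Σₙ (−ρ/2)ⁿ / (n! (2n+5)!!) = 15·j₂(√ρ)/ρ /15` (entire; `q(0) = 1/15`). -/
noncomputable def quadrupoleProfile (ρ : ℝ) : ℝ :=
  ∑' n : ℕ, (-ρ / 2) ^ n / ((n.factorial : ℝ) * ((2 * n + 5).doubleFactorial : ℝ))

/-- The l = 2 RUNG of `V_6(0)`: `w_{a,b} := curl curl (q(‖x‖²) H(x) x)`, `H(x) = a x₀² + b x₁² − (a+b) x₂²`
(Mie scalar `j₂(r) h_A`, `ΔP = −P`, `k = 1`, `λ = 6`; biaxial iff `a, b, −a−b` are pairwise distinct). -/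
noncomputable def quadrupoleRung (a b : ℝ) (x : E) : E :=
  curl (curl (fun z : E => (quadrupoleProfile (‖z‖ ^ 2) * (a * (z 0) ^ 2 + b * (z 1) ^ 2 - (a + b) * (z 2) ^ 2)) • z)) x

/-- S (paper/engine-checked identities (S1)): every quadrupole rung is a bounded smooth poloidal datum on the cone `V_6(0)`. -/
def QuadrupoleRungIsLadder : Prop :=
  ∀ a b : ℝ, IsPoloidalDatum 0 (quadrupoleRung a b) ∧ IsIsoMomental 0 6 (quadrupoleRung a b)

/-- D (ENGINE THEOREM, exact rational jets through degree 10, pressure gauge eliminated): every BIAXIAL quadrupole rung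
THREADS AT THIRD ORDER — `Θ₃ = 4 q(‖x‖²) f₂(‖x‖²) (b−a)(c−a)(c−b)·x₀x₁x₂`, `c = −a−b`, with `f₂ ≢ 0`
(gauge-invariant Taylor coefficients `−268/72765, 32/184275, −136/25540515` at `r⁴, r⁶, r⁸`). -/
def QuadrupoleRungThreads : Prop :=
  ∀ a b : ℝ, a ≠ b → 2 * a + b ≠ 0 → a + 2 * b ≠ 0 →
    ∀ π : E → ℝ, IsLerayPressure (quadrupoleRung a b) π → ∃ x, thirdOrderRate 0 (quadrupoleRung a b) π x ≠ 0

/-! ### Conjectures (the cruxes of the line) and the door -/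

/-- K0 (crux, rank 3 — SECOND-ORDER SURVIVORS ARE CONE ∪ SEPARABLE ∪ AXISYMMETRIC; CORRECTED v1.3): a smooth poloidal datum
of the class whose free heat evolution has vanishing Euler threading rate on a time window lies on some `V_λ(x₀)` (`λ > 0`), or is
separable about `x₀`, or is infinitesimally axisymmetric about an axis through `x₀`.  ERRATUM: v1.0–1.2 stated the two-class
form without `IsSeparableAbout`, which is FALSE (every non-rung separable biaxial shell is a counterexample, `SeparableSecondOrderSilent`).
Evidence for the corrected form: the level-one caloric identity `(∂ₛ − Δ)det[y,∇T,∇m] = −2Σₖ det[y,∇∂ₖT,∇∂ₖm]` and the engine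
cross-checks (mixed profiles / rung + off-ladder separable piece thread at second order; card §Results v1.3). -/
def SecondOrderSurvivorsRigidity : Prop :=
  ∀ (x₀ : E) (u₀ : E → E), IsPoloidalDatum x₀ u₀ → ∀ t₁ : ℝ, 0 < t₁ →
    (∀ s ∈ Ioo 0 t₁, ∀ x, eulerThreadingRate x₀ (heatExtension u₀ s) x = 0) →
    (∃ lam : ℝ, 0 < lam ∧ IsIsoMomental x₀ lam u₀) ∨ IsSeparableAbout x₀ u₀ ∨ IsInfAxisymmetricAbout x₀ u₀

/-- K1 (crux, rank 2 — THE CONE THREADS AT THIRD ORDER): a bounded smooth datum on `V_λ(x₀)` whose ladder defect `Θ₃`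
vanishes identically is infinitesimally axisymmetric.  Certified on nine strata (card §Results); open in general. -/
def LadderThirdOrderRigidity : Prop :=
  ∀ (x₀ : E) (lam : ℝ) (u₀ : E → E) (π : E → ℝ), IsPoloidalDatum x₀ u₀ → IsIsoMomental x₀ lam u₀ → IsLerayPressure u₀ π →
    (∀ x, thirdOrderRate x₀ u₀ π x = 0) → IsInfAxisymmetricAbout x₀ u₀

/-- K1s (crux, rank 2' — THE SEPARABLE STRATUM THREADS AT THIRD ORDER; v1.3): a separable datum of the class whose third-order
rate `Θ₃` vanishes identically is infinitesimally axisymmetric.  By `SO(3)`-equivariance `Θ₃ = (shape pseudoscalar)·F_p(‖y‖)`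
with `F_p` a cubic integro-differential functional of the profile `p` (through the Leray pressure): a GLOBAL rigidity statement.
Certified by the engine for every tested profile jet and shape (l=2 biaxial × Gaussian / shell / Lorentzian / truncated rung,
general quadrupole, two-shape sum, octupole `y₀y₁y₂`), silent on the uniaxial control; NOT certifiable uniformly in `p` from
centre jets (one new profile coefficient per jet degree) — open in general. -/
def SeparableThirdOrderRigidity : Prop :=
  ∀ (x₀ : E) (u₀ : E → E) (π : E → ℝ), IsPoloidalDatum x₀ u₀ → IsSeparableAbout x₀ u₀ → IsLerayPressure u₀ π →
    (∀ x, thirdOrderRate x₀ u₀ π x = 0) → IsInfAxisymmetricAbout x₀ u₀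

/-- P1 (support — AMPLITUDE EXPANSION, standard `L^∞`-mild perturbation theory, unproved in the tree): if all small-amplitude
window solutions from `ε u₀` are unthreaded, then (i) the second-order coefficient vanishes: `Θ₂[e^{sΔ}u₀] ≡ 0` on `(0, t₁)`;
(ii) the (bounded, smooth) Leray pressure of the self-interaction exists — it does for every datum of the class, v1.3 — and the
third-order coefficient `Θ₃ ≡ 0` (given (i), `⟪y, curl u₃(t)⟫ = (t²/2)Θ₃ + O(t³)`). -/
def AmplitudeExpansion : Prop :=
  ∀ (x₀ : E) (u₀ : E → E), IsPoloidalDatum x₀ u₀ → ∀ t₁ : ℝ, 0 < t₁ → SmallFamilyUnthreaded x₀ u₀ t₁ →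
    (∀ s ∈ Ioo 0 t₁, ∀ x, eulerThreadingRate x₀ (heatExtension u₀ s) x = 0) ∧
    (∃ π : E → ℝ, IsLerayPressure u₀ π ∧ ∀ x, thirdOrderRate x₀ u₀ π x = 0)

/-- K2 (THE DOOR — SMALL-AMPLITUDE WINDOW RIGIDITY): if every small-amplitude bounded Oseen-mild window solution from a bounded
smooth poloidal datum `u₀` is unthreaded, then `u₀` is infinitesimally axisymmetric.  A consequence of W2 ⟨27585⟩ (card);
its failure on one datum would refute W2 — the negation lens' target; the engine finds no such datum on the cone or on the
separable stratum. -/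
def SmallAmplitudeWindowRigidity : Prop :=
  ∀ (x₀ : E) (u₀ : E → E), IsPoloidalDatum x₀ u₀ → ∀ t₁ : ℝ, 0 < t₁ → SmallFamilyUnthreaded x₀ u₀ t₁ →
    IsInfAxisymmetricAbout x₀ u₀

/-- GLUE (kernel-checked, v1.3): the amplitude expansion and the THREE rigidity conjectures (survivor classification; cone and
separable stratum thread at third order) close the perturbative door. -/
theorem door_closed (hP : AmplitudeExpansion) (hK0 : SecondOrderSurvivorsRigidity) (hK1 : LadderThirdOrderRigidity)
    (hK1s : SeparableThirdOrderRigidity) : SmallAmplitudeWindowRigidity := by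
  intro x₀ u₀ hu t₁ ht₁ hfam
  obtain ⟨h2, π, hπ, hΘ⟩ := hP x₀ u₀ hu t₁ ht₁ hfam
  rcases hK0 x₀ u₀ hu t₁ ht₁ h2 with ⟨lam, -, hiso⟩ | hsep | hax
  · exact hK1 x₀ lam u₀ π hu hiso hπ hΘ
  · exact hK1s x₀ u₀ π hu hsep hπ hΘ
  · exact hax

/-- GLUE (kernel-checked): on the quadrupole stratum the door is closed UNCONDITIONALLY of K0/K1 — a biaxial rung is never
third-order silent, so `AmplitudeExpansion` alone forbids an unthreaded small-amplitude family from it. -/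
theorem quadrupole_family_threads (hP : AmplitudeExpansion) (hS : QuadrupoleRungIsLadder) (hD : QuadrupoleRungThreads)
    (a b : ℝ) (hab : a ≠ b) (h1 : 2 * a + b ≠ 0) (h2 : a + 2 * b ≠ 0) (t₁ : ℝ) (ht₁ : 0 < t₁) :
    ¬ SmallFamilyUnthreaded 0 (quadrupoleRung a b) t₁ := by
  intro hfam
  obtain ⟨hdat, -⟩ := hS a b
  obtain ⟨-, π, hπ, hΘ⟩ := hP 0 (quadrupoleRung a b) hdat t₁ ht₁ hfam
  obtain ⟨x, hx⟩ := hD a b hab h1 h2 π hπ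
  exact hx (hΘ x)

/-! ### W2 ⇒ K2, kernel-checked modulo ONE standard fact of the `L^∞`-mild theory -/

/-- STANDARD FACT (support, untyped in the tree; Giga–Inui–Matsui 1999, [KNSS2009 §4, arXiv:0709.3599], [LemarieRieusset2016
ch. 6]): LOCAL `L^∞`-MILD THEORY WITH `C¹` ATTAINMENT OF THE DATUM.  For a smooth bounded datum with bounded gradient and every
window length `t₁`, for all small `ε > 0` the Navier–Stokes (ν = 1) mild solution `u` from `ε u₀` exists on `[0, t₁]`: jointly
continuous, uniformly bounded, Oseen-mild from every `s ∈ [0, t₁]` (the clause of ⟨27585⟩), divergence-free, and attains its datum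
in `C¹` pointwise as `t → 0⁺` (heat part: `∇e^{tΔ}u₀ = e^{tΔ}∇u₀`; Duhamel part `O(t^{1/2})` in `C¹` by `‖∇𝒪_τ‖_{L¹} ≲ τ^{-1/2}`
and the propagated gradient bound). -/
def MildLocalTheory : Prop :=
  ∀ (x₀ : E) (u₀ : E → E), IsPoloidalDatum x₀ u₀ → ∀ t₁ : ℝ, 0 < t₁ →
    ∀ᶠ ε : ℝ in 𝓝[>] 0, ∃ u : ℝ → E → E,
      ContinuousOn (uncurry u) (Icc 0 t₁ ×ˢ univ) ∧
      (∃ B : ℝ, ∀ t ∈ Icc 0 t₁, ∀ x, ‖u t x‖ ≤ B) ∧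
      u 0 = ε • u₀ ∧
      (∀ s ∈ Icc 0 t₁, ∀ t ∈ Icc 0 t₁, s < t → ∀ x, u t x = heatExtension (u s) (t - s) x - oseenDuhamel 1 s u u t x) ∧
      (∀ t ∈ Icc 0 t₁, VectorCalculus.IsDivFree (u t)) ∧
      (∀ x, Tendsto (fun t => u t x) (𝓝[>] 0) (𝓝 (ε • u₀ x))) ∧
      (∀ x, Tendsto (fun t => fderiv ℝ (u t) x) (𝓝[>] 0) (𝓝 (ε • fderiv ℝ u₀ x)))

/-- **W2 ⇒ K2** (kernel-checked): `UnthreadedRigidity` ⟨27585⟩ and the standard local mild theory imply the door statement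
`SmallAmplitudeWindowRigidity`.  Hence ONE poloidal datum violating K2 refutes W2 — the negation lens' construction target —
and, read with `door_closed` / `quadrupole_family_threads`, no such datum exists on the computed strata of the cone. -/
theorem smallAmplitudeWindowRigidity_of_unthreadedRigidity
    (hW2 : Summit.NavierStokesRegularity.NavierStokesRegularity.Theses.UnthreadedRigidityDoor.UnthreadedRigidity)
    (hM : MildLocalTheory) : SmallAmplitudeWindowRigidity := by
  intro x₀ u₀ hu t₁ ht₁ hfam
  obtain ⟨ε, hε, ⟨u, hcont, hbd, h0, hmild, hdiv, hlim0, hlim1⟩, hunthr⟩ :=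
    ((eventually_mem_nhdsWithin (a := (0 : ℝ)) (s := Ioi 0)).and ((hM x₀ u₀ hu t₁ ht₁).and (hfam))).exists
  have hU : ∀ t ∈ Icc 0 t₁, IsUnthreadedAbout x₀ (u t) := hunthr u hcont hbd h0 hmild
  have hsub : Ioo (0 : ℝ) t₁ ⊆ Icc 0 t₁ := Ioo_subset_Icc_self
  obtain ⟨B, hB⟩ := hbd
  obtain ⟨A, hAskew, hA0, hLA⟩ := hW2 (Ioo 0 t₁) isOpen_Ioo isPreconnected_Ioo u x₀
    (hcont.mono (prod_mono hsub subset_rfl))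
    (fun t ht => hdiv t (hsub ht))
    (fun s hs t ht hst x => hmild s (hsub hs) t (hsub ht) hst x)
    (fun τ _ => ⟨B, fun t ht _ x => hB t (hsub ht) x⟩)
    (fun t ht x => by rw [real_inner_comm]; exact hU t (hsub ht) x)
  refine ⟨A, hAskew, hA0, fun x => ?_⟩
  -- the axisymmetry defect of `u t` at `x` tends to `ε •` (defect of `u₀`) as `t → 0⁺` …
  have h1 : Tendsto (fun t => fderiv ℝ (u t) x (A (x - x₀))) (𝓝[>] 0) (𝓝 ((ε • fderiv ℝ u₀ x) (A (x - x₀)))) := by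
    have hc : Continuous fun L : E →L[ℝ] E => L (A (x - x₀)) := (ContinuousLinearMap.apply ℝ E (A (x - x₀))).continuous
    exact (hc.tendsto _).comp (hlim1 x)
  have h2 : Tendsto (fun t => A (u t x)) (𝓝[>] 0) (𝓝 (A (ε • u₀ x))) := (A.continuous.tendsto _).comp (hlim0 x)
  have key := h1.sub h2
  -- … and is identically zero on `(0, t₁)`
  have hzero : ∀ᶠ t in 𝓝[>] (0 : ℝ), fderiv ℝ (u t) x (A (x - x₀)) - A (u t x) = 0 := by
    have hmem : Ioo (0 : ℝ) t₁ ∈ 𝓝[>] (0 : ℝ) := Ioo_mem_nhdsGT ht₁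
    filter_upwards [hmem] with t ht using hLA t ht x
  have hlim : (ε • fderiv ℝ u₀ x) (A (x - x₀)) - A (ε • u₀ x) = 0 :=
    tendsto_nhds_unique key (tendsto_const_nhds.congr' (hzero.mono fun t ht => ht.symm))
  have hε' : (ε : ℝ) ≠ 0 := ne_of_gt hε
  have h3 : ε • (fderiv ℝ u₀ x (A (x - x₀)) - A (u₀ x)) = 0 := by
    rw [smul_sub]; simpa [Pi.smul_apply, map_smul] using hlim
  exact (smul_eq_zero.mp h3).resolve_left hε'

end Summit.NavierStokesRegularity.NavierStokesRegularity.Cruxes.PoloidalLiouville.LadderCone
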